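import Summits.CriticalPhenomena.PercolationContinuityZ3.Theorems.PercNearOneGluingNoHeavyLowerTailQ7ThreeRecipeR5
import Literature.Probability.Percolation.KozmaNitzanPreFKG
import HarnessLib

/-!
# `NoHeavyLowerTail` (stmt-CriticalPhenomena-4575) — Kozma–Nitzan Question 7 for three relays
# under the strong Lemma-2 condition (the `R5` regime)

Support file (`--supports stmt-CriticalPhenomena-4575`), coupling seat `prim-cplus-coupling` (gen 4).  No definitions, no
named facts, no sorries.

Kozma–Nitzan (arXiv:2401.12397) ask in Question 7 (p. 36) whether, for the relay `z ∈ A` minimising `P(z ↔ b)`, the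
pre-FKG inequality (41) `P(o ↔ b, o ↔ A) ≥ P(o ↔ A, z ↔ b)` holds; for `|A| = 3` their Theorem 2 (pp. 8–9) proves it when
`μ(C(b)∩A = {z}) ≤ μ(C(b)∩A = {x,y})`, and Lemma 2 (p. 6) is the inequality
`φ({x,y})·μ(M) ≥ μ(o↔x, M) + μ(o↔y, M)` (`M` = the three relays pairwise separated, `φ({x,y}) = μ(o ↔ {x,y} | z ↮ {x,y})`).

* `q7Three_of_strongLemma2` — **Question 7 for three relays holds whenever**
  `φ({x,y})·μ(M) ≥ μ(o↔x, x ↮ {y,z}) + μ(o↔y, y ↮ {x,z})`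
  (Lemma 2 with the separated event `M` replaced by the one-relay separation events `E₁ = {x ↮ y,z}`, `E₂ = {y ↮ x,z}` in
  the numerators; denominator-free: `(μ(E₁∩{o↔x}) + μ(E₂∩{o↔y}))·μ(D) ≤ μ(D∩({o↔x}∪{o↔y}))·μ(M)`, `D = {z ↮ x,y}`).
  Proof: the `R5` lower bound `q7r5_level1` (four set-BHK steps), Kozma–Nitzan's Lemma 3(ii) for the pairs `(z,x)`, `(z,y)`
  with `Q = {z ↮ {x,y}}` (tree theorem `KozmaNitzan2024_lemma3_ii_notConn`), two more set-BHK steps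
  (`μ(E₁)μ(E₁∩{x↔b}∩{y↔z}) ≤ μ(E₁∩{y↔z})μ(E₁∩{x↔b})` and its mirror), the hypotheses `μ(z↔b) ≤ μ(x↔b), μ(y↔b)` once
  more through the cells of `μ(x↔b) − μ(z↔b)`, and real arithmetic.
This regime is complementary to Theorem 2's: by exact partition-law computation (seat memo A5-COUPLING-gen4.md) it contains
most of the instances with `μ(C(b)∩A={z}) > μ(C(b)∩A={x,y})` and a negative Kozma–Nitzan bound found by the ttrl census.
[cite: KozmaNitzan2024, Question 7 (p. 36), Theorem 2 (pp. 8–9), Lemma 2 (p. 6), Lemma 3(ii) (pp. 6–7)]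
[cite: VandenbergHaggstromKahn2005, Thms 1.3–1.4]
-/

namespace Summit.CriticalPhenomena.PercolationContinuityZ3.Theorems

open MeasureTheory Set Literature.Probability.LatticeModels Literature.Probability.Percolation
open scoped Classical BigOperators
open Q7ThreeCut Q7ThreeRecipes

noncomputable section

variable {n : ℕ}

/-- **Two auxiliary set-BHK inequalities**: for distinct `x, y, z`, with `E₁ = {x↮y} ∩ {x↮z}` and `E₂ = {x↮y} ∩ {y↮z}`,
`μ(E₁)·μ(E₁ ∩ {x↔b} ∩ {y↔z}) ≤ μ(E₁ ∩ {y↔z})·μ(E₁ ∩ {x↔b})` and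
`μ(E₂)·μ(E₂ ∩ {y↔b} ∩ {x↔z}) ≤ μ(E₂ ∩ {x↔z})·μ(E₂ ∩ {y↔b})`
(BHK Thm 1.4 for the source `x` and the set `{y,z}`: `{x↔b}` is increasing in `C_x`, `{y↔z}` in `C_y ∪ C_z`).
[cite: VandenbergHaggstromKahn2005, Thm 1.4] -/
theorem q7r5_pairAtoms (w : Sym2 (Fin n) → unitInterval) (b x y z : Fin n) (hxy : x ≠ y) (hxz : x ≠ z) (hyz : y ≠ z) :
    (prodBernoulli w).real ((openConn x y)ᶜ ∩ (openConn x z)ᶜ) *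
        (prodBernoulli w).real (((openConn x y)ᶜ ∩ (openConn x z)ᶜ) ∩ openConn x b ∩ openConn y z) ≤
      (prodBernoulli w).real (((openConn x y)ᶜ ∩ (openConn x z)ᶜ) ∩ openConn x b) *
        (prodBernoulli w).real (((openConn x y)ᶜ ∩ (openConn x z)ᶜ) ∩ openConn y z) ∧
    (prodBernoulli w).real ((openConn x y)ᶜ ∩ (openConn y z)ᶜ) *
        (prodBernoulli w).real (((openConn x y)ᶜ ∩ (openConn y z)ᶜ) ∩ openConn y b ∩ openConn x z) ≤
      (prodBernoulli w).real (((openConn x y)ᶜ ∩ (openConn y z)ᶜ) ∩ openConn y b) *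
        (prodBernoulli w).real (((openConn x y)ᶜ ∩ (openConn y z)ᶜ) ∩ openConn x z) := by
  obtain ⟨-, h14⟩ := stub_bhkSets
  set Fx : Set (Sym2 (Fin n)) → ℝ := (openConn x b : Set (BondConfig (Fin n))).indicator 1 with hFx
  set Fy : Set (Sym2 (Fin n)) → ℝ := (openConn y b : Set (BondConfig (Fin n))).indicator 1 with hFy
  set Gyz : Set (Sym2 (Fin n)) → ℝ := (openConn y z : Set (BondConfig (Fin n))).indicator 1 with hGyz
  set Gxz : Set (Sym2 (Fin n)) → ℝ := (openConn x z : Set (BondConfig (Fin n))).indicator 1 with hGxz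
  have hFxm : Monotone Fx := monotone_indicator_of_isUpperSet (isUpperSet_openConn x b)
  have hFym : Monotone Fy := monotone_indicator_of_isUpperSet (isUpperSet_openConn y b)
  have hGyzm : Monotone Gyz := monotone_indicator_of_isUpperSet (isUpperSet_openConn y z)
  have hGxzm : Monotone Gxz := monotone_indicator_of_isUpperSet (isUpperSet_openConn x z)
  have hCx : ∀ ω : BondConfig (Fin n), (⋃ s ∈ ({x} : Finset (Fin n)), openEdgeCluster ω s) = openEdgeCluster ω x :=
    fun ω => Finset.set_biUnion_singleton x _
  have hCy : ∀ ω : BondConfig (Fin n), (⋃ s ∈ ({y} : Finset (Fin n)), openEdgeCluster ω s) = openEdgeCluster ω y :=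
    fun ω => Finset.set_biUnion_singleton y _
  have hCyz : ∀ ω : BondConfig (Fin n), (⋃ s ∈ ({y, z} : Finset (Fin n)), openEdgeCluster ω s) =
      openEdgeCluster ω y ∪ openEdgeCluster ω z := by
    intro ω; rw [Finset.set_biUnion_insert, Finset.set_biUnion_singleton]
  have hCxz : ∀ ω : BondConfig (Fin n), (⋃ s ∈ ({x, z} : Finset (Fin n)), openEdgeCluster ω s) =
      openEdgeCluster ω x ∪ openEdgeCluster ω z := by
    intro ω; rw [Finset.set_biUnion_insert, Finset.set_biUnion_singleton]
  have sub2 : ∀ (ω : BondConfig (Fin n)) (s t : Fin n), openEdgeCluster ω s ∪ openEdgeCluster ω t ⊆ ω :=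
    fun ω s t => union_subset (openEdgeCluster_subset ω s) (openEdgeCluster_subset ω t)
  have eFx : ∀ ω : BondConfig (Fin n), Fx (openEdgeCluster ω x) = (openConn x b : Set (BondConfig (Fin n))).indicator 1 ω :=
    fun ω => indicator_openConn_of_cluster_subset subset_rfl (openEdgeCluster_subset ω x)
  have eFy : ∀ ω : BondConfig (Fin n), Fy (openEdgeCluster ω y) = (openConn y b : Set (BondConfig (Fin n))).indicator 1 ω :=
    fun ω => indicator_openConn_of_cluster_subset subset_rfl (openEdgeCluster_subset ω y)
  have eGyz : ∀ ω : BondConfig (Fin n), Gyz (openEdgeCluster ω y ∪ openEdgeCluster ω z) =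
      (openConn y z : Set (BondConfig (Fin n))).indicator 1 ω := fun ω =>
    indicator_openConn_of_cluster_subset subset_union_left (sub2 ω y z)
  have eGxz : ∀ ω : BondConfig (Fin n), Gxz (openEdgeCluster ω x ∪ openEdgeCluster ω z) =
      (openConn x z : Set (BondConfig (Fin n))).indicator 1 ω := fun ω =>
    indicator_openConn_of_cluster_subset subset_union_left (sub2 ω x z)
  have prod_ind : ∀ (A B : Set (BondConfig (Fin n))) (ω : BondConfig (Fin n)),
      A.indicator (1 : BondConfig (Fin n) → ℝ) ω * B.indicator 1 ω = (A ∩ B).indicator 1 ω := fun A B ω =>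
    (congrFun (inter_indicator_one (s := A) (t := B) (M₀ := ℝ)) ω).symm
  have hE1fin : {ω : BondConfig (Fin n) | ∀ s ∈ ({x} : Finset (Fin n)), ∀ t ∈ ({y, z} : Finset (Fin n)),
      ¬ (openGraph ω).Reachable s t} = (openConn x y)ᶜ ∩ (openConn x z)ᶜ := by
    ext ω
    simp only [mem_setOf_eq, Finset.mem_singleton, forall_eq, Finset.mem_insert, forall_eq_or_imp,
      mem_inter_iff, mem_compl_iff]
    rfl
  have hE2fin : {ω : BondConfig (Fin n) | ∀ s ∈ ({y} : Finset (Fin n)), ∀ t ∈ ({x, z} : Finset (Fin n)),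
      ¬ (openGraph ω).Reachable s t} = (openConn x y)ᶜ ∩ (openConn y z)ᶜ := by
    ext ω
    simp only [mem_setOf_eq, Finset.mem_singleton, forall_eq, Finset.mem_insert, forall_eq_or_imp,
      mem_inter_iff, mem_compl_iff]
    exact and_congr (not_congr ⟨SimpleGraph.Reachable.symm, SimpleGraph.Reachable.symm⟩) Iff.rfl
  refine ⟨?_, ?_⟩
  · have key := h14 n w {x} {y, z} Fx Gyz hFxm hGyzm (by
      simp only [Finset.disjoint_singleton_left, Finset.mem_insert, Finset.mem_singleton, not_or]
      exact ⟨hxy, hxz⟩)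
    simp only [hE1fin, hCx, hCyz] at key
    simp only [eFx, eGyz, prod_ind, setIntegral_indicator_one_eq] at key
    simpa only [inter_assoc] using key
  · have key := h14 n w {y} {x, z} Fy Gxz hFym hGxzm (by
      simp only [Finset.disjoint_singleton_left, Finset.mem_insert, Finset.mem_singleton, not_or]
      exact ⟨Ne.symm hxy, hyz⟩)
    simp only [hE2fin, hCy, hCxz] at key
    simp only [eFy, eGxz, prod_ind, setIntegral_indicator_one_eq] at key
    simpa only [inter_assoc] using key

/-- The real-arithmetic core of `q7Three_of_strongLemma2`: with `pE₁ = q₁ + pM`, `pE₂ = q₂ + pM`,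
`pM·G = Σ (seven nonnegative products)` for the quantity `G` bounded by `q7r5_level1`. [folklore] -/
theorem q7r5_arith {pD pM oD o1 o2 W Mx My m1p m2p q1 q2 xbE2 ybE1 : ℝ}
    (h0 : 0 ≤ pD) (h1 : 0 ≤ o1) (h2 : 0 ≤ o2) (hq1 : 0 ≤ q1) (hq2 : 0 ≤ q2) (hM : 0 < pM) (hWnn : 0 ≤ W)
    (hW1 : Mx ≤ W) (hW2 : My ≤ W) (hx2 : xbE2 ≤ m2p + W) (hy1 : ybE1 ≤ m1p + W)
    (F1 : m1p * pM ≤ q1 * Mx) (F2 : m2p * pM ≤ q2 * My) (cond : (o1 + o2) * pD ≤ oD * pM) :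
    0 ≤ oD * W * (q1 + pM) * (q2 + pM) - o2 * xbE2 * pD * (q1 + pM) - o1 * ybE1 * pD * (q2 + pM) := by
  have hE1 : 0 ≤ q1 + pM := by linarith
  have hE2 : 0 ≤ q2 + pM := by linarith
  have s1 : 0 ≤ o2 * pD * (q1 + pM) * pM * ((m2p + W) - xbE2) :=
    mul_nonneg (mul_nonneg (mul_nonneg (mul_nonneg h2 h0) hE1) hM.le) (by linarith)
  have s2 : 0 ≤ o1 * pD * (q2 + pM) * pM * ((m1p + W) - ybE1) :=
    mul_nonneg (mul_nonneg (mul_nonneg (mul_nonneg h1 h0) hE2) hM.le) (by linarith)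
  have s3 : 0 ≤ W * (q1 + pM) * (q2 + pM) * (oD * pM - (o1 + o2) * pD) :=
    mul_nonneg (mul_nonneg (mul_nonneg hWnn hE1) hE2) (by linarith)
  have s4 : 0 ≤ o1 * pD * (q2 + pM) * (q1 * Mx - m1p * pM) :=
    mul_nonneg (mul_nonneg (mul_nonneg h1 h0) hE2) (by linarith)
  have s5 : 0 ≤ o2 * pD * (q1 + pM) * (q2 * My - m2p * pM) :=
    mul_nonneg (mul_nonneg (mul_nonneg h2 h0) hE1) (by linarith)
  have s6 : 0 ≤ o1 * pD * (q2 + pM) * q1 * (W - Mx) :=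
    mul_nonneg (mul_nonneg (mul_nonneg (mul_nonneg h1 h0) hE2) hq1) (by linarith)
  have s7 : 0 ≤ o2 * pD * (q1 + pM) * q2 * (W - My) :=
    mul_nonneg (mul_nonneg (mul_nonneg (mul_nonneg h2 h0) hE1) hq2) (by linarith)
  have key : pM * (oD * W * (q1 + pM) * (q2 + pM) - o2 * xbE2 * pD * (q1 + pM) - o1 * ybE1 * pD * (q2 + pM)) =
      o2 * pD * (q1 + pM) * pM * ((m2p + W) - xbE2) + o1 * pD * (q2 + pM) * pM * ((m1p + W) - ybE1) +
      W * (q1 + pM) * (q2 + pM) * (oD * pM - (o1 + o2) * pD) + o1 * pD * (q2 + pM) * (q1 * Mx - m1p * pM) +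
      o2 * pD * (q1 + pM) * (q2 * My - m2p * pM) + o1 * pD * (q2 + pM) * q1 * (W - Mx) +
      o2 * pD * (q1 + pM) * q2 * (W - My) := by ring
  by_contra hneg
  have hneg' := not_le.mp hneg
  have : pM * (oD * W * (q1 + pM) * (q2 + pM) - o2 * xbE2 * pD * (q1 + pM) - o1 * ybE1 * pD * (q2 + pM)) < 0 :=
    mul_neg_of_pos_of_neg hM hneg'
  linarith

/-- **Kozma–Nitzan's Question 7 for three relays in the strong-Lemma-2 regime.**  Let `x, y, z` be distinct relays
with `z` the least `b`-reliable (`μ(z↔b) ≤ μ(x↔b)`, `μ(z↔b) ≤ μ(y↔b)`), let `M = {x↮y} ∩ {x↮z} ∩ {y↮z}` have positive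
probability, `D = {x↮z} ∩ {y↮z}`, `E₁ = {x↮y} ∩ {x↮z}`, `E₂ = {x↮y} ∩ {y↮z}`, and assume the strong Lemma-2 inequality
`(μ(E₁∩{o↔x}) + μ(E₂∩{o↔y}))·μ(D) ≤ μ(D ∩ ({o↔x}∪{o↔y}))·μ(M)`
(i.e. `φ({x,y})·μ(M) ≥ φ(x)μ(E₁) + φ(y)μ(E₂)` in Kozma–Nitzan's notation; their Lemma 2 is the same inequality with `M`
in place of `E₁, E₂`).  Then the pre-FKG inequality (41) holds for the relay `z`:
`μ({z↔b} ∩ ({o↔x}∪{o↔y}∪{o↔z})) ≤ μ({o↔b} ∩ ({o↔x}∪{o↔y}∪{o↔z}))`.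
[cite: KozmaNitzan2024, Question 7 (p. 36), Lemma 2 (p. 6), Lemma 3(ii) (pp. 6–7)] [cite: VandenbergHaggstromKahn2005, Thms 1.3–1.4] -/
theorem q7Three_of_strongLemma2 (w : Sym2 (Fin n) → unitInterval) (o b x y z : Fin n)
    (hxy : x ≠ y) (hxz : x ≠ z) (hyz : y ≠ z)
    (hzx : (prodBernoulli w).real (openConn z b) ≤ (prodBernoulli w).real (openConn x b))
    (hzy : (prodBernoulli w).real (openConn z b) ≤ (prodBernoulli w).real (openConn y b))
    (hM : 0 < (prodBernoulli w).real ((openConn x y)ᶜ ∩ (openConn x z)ᶜ ∩ (openConn y z)ᶜ))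
    (hcond : ((prodBernoulli w).real (((openConn x y)ᶜ ∩ (openConn x z)ᶜ) ∩ openConn o x) +
          (prodBernoulli w).real (((openConn x y)ᶜ ∩ (openConn y z)ᶜ) ∩ openConn o y)) *
        (prodBernoulli w).real ((openConn x z)ᶜ ∩ (openConn y z)ᶜ) ≤
      (prodBernoulli w).real (((openConn x z)ᶜ ∩ (openConn y z)ᶜ) ∩ (openConn o x ∪ openConn o y)) *
        (prodBernoulli w).real ((openConn x y)ᶜ ∩ (openConn x z)ᶜ ∩ (openConn y z)ᶜ)) :
    (prodBernoulli w).real (openConn z b ∩ (openConn o x ∪ openConn o y ∪ openConn o z)) ≤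
      (prodBernoulli w).real (openConn o b ∩ (openConn o x ∪ openConn o y ∪ openConn o z)) := by
  have lev1 := q7r5_level1 w o b x y z hxy hxz hyz
  obtain ⟨f1, f2⟩ := q7r5_pairAtoms w b x y z hxy hxz hyz
  set μ := prodBernoulli w with hμ
  -- events
  set D : Set (BondConfig (Fin n)) := (openConn x z)ᶜ ∩ (openConn y z)ᶜ with hD
  set E1 : Set (BondConfig (Fin n)) := (openConn x y)ᶜ ∩ (openConn x z)ᶜ with hE1
  set E2 : Set (BondConfig (Fin n)) := (openConn x y)ᶜ ∩ (openConn y z)ᶜ with hE2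
  set M : Set (BondConfig (Fin n)) := (openConn x y)ᶜ ∩ (openConn x z)ᶜ ∩ (openConn y z)ᶜ with hMdef
  set XB : Set (BondConfig (Fin n)) := openConn x b with hXB
  set YB : Set (BondConfig (Fin n)) := openConn y b with hYB
  set ZB : Set (BondConfig (Fin n)) := openConn z b with hZB
  set XZ : Set (BondConfig (Fin n)) := openConn x z with hXZ
  set YZ : Set (BondConfig (Fin n)) := openConn y z with hYZ
  -- Lemma 3(ii): given `{z ↮ x,y}`, the relay `z` is still the least reliable
  have hDset : {ω : BondConfig (Fin n) | ∀ u ∈ ({x, y} : Set (Fin n)), ¬ (openGraph ω).Reachable z u} = D := by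
    ext ω
    simp only [mem_setOf_eq, mem_insert_iff, mem_singleton_iff, forall_eq_or_imp, forall_eq, hD,
      mem_inter_iff, mem_compl_iff]
    exact and_congr (not_congr ⟨SimpleGraph.Reachable.symm, SimpleGraph.Reachable.symm⟩)
      (not_congr ⟨SimpleGraph.Reachable.symm, SimpleGraph.Reachable.symm⟩)
  have B1 : μ.real (D ∩ ZB) ≤ μ.real (D ∩ XB) := by
    have h := KozmaNitzan2024_lemma3_ii_notConn w z x b ({x, y} : Set (Fin n)) hzx
    rw [hDset] at h; simpa only [inter_comm] using h
  have B2 : μ.real (D ∩ ZB) ≤ μ.real (D ∩ YB) := by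
    have h := KozmaNitzan2024_lemma3_ii_notConn w z y b ({x, y} : Set (Fin n)) hzy
    rw [hDset] at h; simpa only [inter_comm] using h
  -- additive decompositions
  have msplit : ∀ (A B : Set (BondConfig (Fin n))), μ.real A = μ.real (A ∩ B) + μ.real (A ∩ Bᶜ) := fun A B => by
    rw [← measureReal_inter_add_sdiff (μ := μ) (s := A) (MeasurableSet.of_discrete : MeasurableSet B), sdiff_eq]
  -- `M` inside `E₁`, `E₂`
  have hME1 : E1 ∩ YZᶜ = M := by rw [hMdef, hE1]
  have hME2 : E2 ∩ XZᶜ = M := by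
    rw [hMdef, hE2]; ext ω; simp only [mem_inter_iff, mem_compl_iff]; tauto
  have sE1 : μ.real E1 = μ.real (E1 ∩ YZ) + μ.real M := by rw [msplit E1 YZ, hME1]
  have sE2 : μ.real E2 = μ.real (E2 ∩ XZ) + μ.real M := by rw [msplit E2 XZ, hME2]
  -- the `M`-masses of `b` on `x` and on `y`
  have hMx : E2 ∩ XB ∩ XZᶜ = D ∩ XB ∩ YBᶜ := by
    ext ω; simp only [mem_inter_iff, mem_compl_iff, hE2, hD]
    constructor
    · rintro ⟨⟨⟨hxy', hyz'⟩, hxb⟩, hxz'⟩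
      exact ⟨⟨⟨hxz', hyz'⟩, hxb⟩, fun hyb => hxy' (conn_trans hxb (conn_symm hyb))⟩
    · rintro ⟨⟨⟨hxz', hyz'⟩, hxb⟩, hyb⟩
      exact ⟨⟨⟨fun h => hyb (conn_trans (conn_symm h) hxb), hyz'⟩, hxb⟩, hxz'⟩
  have hMy : E1 ∩ YB ∩ YZᶜ = D ∩ YB ∩ XBᶜ := by
    ext ω; simp only [mem_inter_iff, mem_compl_iff, hE1, hD]
    constructor
    · rintro ⟨⟨⟨hxy', hxz'⟩, hyb⟩, hyz'⟩
      exact ⟨⟨⟨hxz', hyz'⟩, hyb⟩, fun hxb => hxy' (conn_trans hxb (conn_symm hyb))⟩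
    · rintro ⟨⟨⟨hxz', hyz'⟩, hyb⟩, hxb⟩
      exact ⟨⟨⟨fun h => hxb (conn_trans h hyb), hxz'⟩, hyb⟩, hyz'⟩
  have hMx' : E1 ∩ XB ∩ YZᶜ = D ∩ XB ∩ YBᶜ := by
    ext ω; simp only [mem_inter_iff, mem_compl_iff, hE1, hD]
    constructor
    · rintro ⟨⟨⟨hxy', hxz'⟩, hxb⟩, hyz'⟩
      exact ⟨⟨⟨hxz', hyz'⟩, hxb⟩, fun hyb => hxy' (conn_trans hxb (conn_symm hyb))⟩
    · rintro ⟨⟨⟨hxz', hyz'⟩, hxb⟩, hyb⟩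
      exact ⟨⟨⟨fun h => hyb (conn_trans (conn_symm h) hxb), hxz'⟩, hxb⟩, hyz'⟩
  have hMy' : E2 ∩ YB ∩ XZᶜ = D ∩ YB ∩ XBᶜ := by
    ext ω; simp only [mem_inter_iff, mem_compl_iff, hE2, hD]
    constructor
    · rintro ⟨⟨⟨hxy', hyz'⟩, hyb⟩, hxz'⟩
      exact ⟨⟨⟨hxz', hyz'⟩, hyb⟩, fun hxb => hxy' (conn_trans hxb (conn_symm hyb))⟩
    · rintro ⟨⟨⟨hxz', hyz'⟩, hyb⟩, hxb⟩
      exact ⟨⟨⟨fun h => hxb (conn_trans h hyb), hyz'⟩, hyb⟩, hxz'⟩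
  -- `D ∩ (XB ∪ YB)` splits as `(D ∩ XB) ⊔ (D ∩ YB ∩ XBᶜ)` and as `(D ∩ YB) ⊔ (D ∩ XB ∩ YBᶜ)`
  have i1 : μ.real (D ∩ (XB ∪ YB)) = μ.real (D ∩ XB) + μ.real (D ∩ YB ∩ XBᶜ) := by
    rw [msplit (D ∩ (XB ∪ YB)) XB]
    congr 2
    · ext ω; simp only [mem_inter_iff, mem_union]; tauto
    · ext ω; simp only [mem_inter_iff, mem_union, mem_compl_iff]; tauto
  have i2 : μ.real (D ∩ (XB ∪ YB)) = μ.real (D ∩ YB) + μ.real (D ∩ XB ∩ YBᶜ) := by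
    rw [msplit (D ∩ (XB ∪ YB)) YB]
    congr 2
    · ext ω; simp only [mem_inter_iff, mem_union]; tauto
    · ext ω; simp only [mem_inter_iff, mem_union, mem_compl_iff]; tauto
  have i3 : μ.real (D ∩ XB) = μ.real (D ∩ XB ∩ YB) + μ.real (D ∩ XB ∩ YBᶜ) := msplit (D ∩ XB) YB
  have i4 : μ.real (E2 ∩ XB) = μ.real (E2 ∩ XB ∩ XZ) + μ.real (D ∩ XB ∩ YBᶜ) := by rw [msplit (E2 ∩ XB) XZ, hMx]
  have i5 : μ.real (E1 ∩ YB) = μ.real (E1 ∩ YB ∩ YZ) + μ.real (D ∩ YB ∩ XBᶜ) := by rw [msplit (E1 ∩ YB) YZ, hMy]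
  have i6 : μ.real (E1 ∩ XB) = μ.real (E1 ∩ XB ∩ YZ) + μ.real (D ∩ XB ∩ YBᶜ) := by rw [msplit (E1 ∩ XB) YZ, hMx']
  have i7 : μ.real (E2 ∩ YB) = μ.real (E2 ∩ YB ∩ XZ) + μ.real (D ∩ YB ∩ XBᶜ) := by rw [msplit (E2 ∩ YB) XZ, hMy']
  -- the hypotheses `μ(zb) ≤ μ(xb), μ(yb)` through the cells
  have hdiff : ∀ (A B : Set (BondConfig (Fin n))), μ.real A ≤ μ.real B → μ.real (A ∩ Bᶜ) ≤ μ.real (B ∩ Aᶜ) := by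
    intro A B h
    have ha := msplit A B; have hb := msplit B A
    rw [inter_comm B A] at hb
    linarith
  have low1 : μ.real (D ∩ ZB) + μ.real (E1 ∩ YB ∩ YZ) ≤ μ.real (ZB ∩ XBᶜ) := by
    have hdj : Disjoint (D ∩ ZB) (E1 ∩ YB ∩ YZ) := by
      rw [Set.disjoint_left]
      rintro ω ⟨⟨-, hyz'⟩, -⟩ ⟨-, hyz''⟩
      exact hyz' hyz''
    rw [← measureReal_union hdj MeasurableSet.of_discrete]
    refine measureReal_mono ?_
    rintro ω (⟨⟨hxz', -⟩, hzb⟩ | ⟨⟨⟨-, hxz'⟩, hyb⟩, hyz'⟩)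
    · exact ⟨hzb, fun hxb => hxz' (conn_trans hxb (conn_symm hzb))⟩
    · exact ⟨conn_trans (conn_symm hyz') hyb, fun hxb => hxz' (conn_trans hxb (conn_trans (conn_symm hyb) hyz'))⟩
  have low2 : μ.real (D ∩ ZB) + μ.real (E2 ∩ XB ∩ XZ) ≤ μ.real (ZB ∩ YBᶜ) := by
    have hdj : Disjoint (D ∩ ZB) (E2 ∩ XB ∩ XZ) := by
      rw [Set.disjoint_left]
      rintro ω ⟨⟨hxz', -⟩, -⟩ ⟨-, hxz''⟩
      exact hxz' hxz''
    rw [← measureReal_union hdj MeasurableSet.of_discrete]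
    refine measureReal_mono ?_
    rintro ω (⟨⟨-, hyz'⟩, hzb⟩ | ⟨⟨⟨-, hyz'⟩, hxb⟩, hxz'⟩)
    · exact ⟨hzb, fun hyb => hyz' (conn_trans hyb (conn_symm hzb))⟩
    · exact ⟨conn_trans (conn_symm hxz') hxb, fun hyb => hyz' (conn_trans hyb (conn_trans (conn_symm hxb) hxz'))⟩
  have up1 : μ.real (XB ∩ ZBᶜ) ≤ μ.real (E1 ∩ XB) + μ.real (D ∩ XB ∩ YB) := by
    refine (measureReal_mono ?_).trans (measureReal_union_le _ _)
    rintro ω ⟨hxb, hzb⟩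
    by_cases hxy' : ω ∈ (openConn x y : Set (BondConfig (Fin n)))
    · refine Or.inr ⟨⟨⟨fun h => hzb (conn_trans (conn_symm h) hxb), fun h => ?_⟩, hxb⟩, conn_trans (conn_symm hxy') hxb⟩
      exact hzb (conn_trans (conn_symm h) (conn_trans (conn_symm hxy') hxb))
    · exact Or.inl ⟨⟨hxy', fun h => hzb (conn_trans (conn_symm h) hxb)⟩, hxb⟩
  have up2 : μ.real (YB ∩ ZBᶜ) ≤ μ.real (E2 ∩ YB) + μ.real (D ∩ XB ∩ YB) := by
    refine (measureReal_mono ?_).trans (measureReal_union_le _ _)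
    rintro ω ⟨hyb, hzb⟩
    by_cases hxy' : ω ∈ (openConn x y : Set (BondConfig (Fin n)))
    · refine Or.inr ⟨⟨⟨fun h => ?_, fun h => hzb (conn_trans (conn_symm h) hyb)⟩, conn_trans hxy' hyb⟩, hyb⟩
      exact hzb (conn_trans (conn_symm h) (conn_trans hxy' hyb))
    · exact Or.inl ⟨⟨hxy', fun h => hzb (conn_trans (conn_symm h) hyb)⟩, hyb⟩
  have H1' := hdiff ZB XB hzx   -- μ(ZB ∩ XBᶜ) ≤ μ(XB ∩ ZBᶜ)
  have H2' := hdiff ZB YB hzy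
  -- real arithmetic: feed `q7r5_arith` (make the events opaque first)
  have hpMD : μ.real M ≤ μ.real D := measureReal_mono (fun ω h => ⟨h.1.2, h.2⟩)
  clear_value D E1 E2 M XB YB ZB XZ YZ
  have h0 : ∀ s : Set (BondConfig (Fin n)), 0 ≤ μ.real s := fun s => measureReal_nonneg
  have hposD : 0 < μ.real D := lt_of_lt_of_le hM hpMD
  have hW1 : μ.real (D ∩ XB ∩ YBᶜ) ≤ μ.real (D ∩ (XB ∪ YB)) - μ.real (D ∩ ZB) := by linarith [B2, i2]
  have hW2 : μ.real (D ∩ YB ∩ XBᶜ) ≤ μ.real (D ∩ (XB ∪ YB)) - μ.real (D ∩ ZB) := by linarith [B1, i1]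
  have hx2 : μ.real (E2 ∩ XB) ≤ μ.real (E2 ∩ YB ∩ XZ) + (μ.real (D ∩ (XB ∪ YB)) - μ.real (D ∩ ZB)) := by
    linarith [i4, low2, H2', up2, i7, i1, i3]
  have hy1 : μ.real (E1 ∩ YB) ≤ μ.real (E1 ∩ XB ∩ YZ) + (μ.real (D ∩ (XB ∪ YB)) - μ.real (D ∩ ZB)) := by
    linarith [i5, low1, H1', up1, i6, i2, i3, i1]
  have F1' : μ.real (E1 ∩ XB ∩ YZ) * μ.real M ≤ μ.real (E1 ∩ YZ) * μ.real (D ∩ XB ∩ YBᶜ) := by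
    have hf := f1
    rw [i6, sE1] at hf
    have e1 : (μ.real (E1 ∩ YZ) + μ.real M) * μ.real (E1 ∩ XB ∩ YZ) =
        μ.real (E1 ∩ YZ) * μ.real (E1 ∩ XB ∩ YZ) + μ.real (E1 ∩ XB ∩ YZ) * μ.real M := by ring
    have e2 : (μ.real (E1 ∩ XB ∩ YZ) + μ.real (D ∩ XB ∩ YBᶜ)) * μ.real (E1 ∩ YZ) =
        μ.real (E1 ∩ YZ) * μ.real (E1 ∩ XB ∩ YZ) + μ.real (E1 ∩ YZ) * μ.real (D ∩ XB ∩ YBᶜ) := by ring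
    linarith
  have F2' : μ.real (E2 ∩ YB ∩ XZ) * μ.real M ≤ μ.real (E2 ∩ XZ) * μ.real (D ∩ YB ∩ XBᶜ) := by
    have hf := f2
    rw [i7, sE2] at hf
    have e1 : (μ.real (E2 ∩ XZ) + μ.real M) * μ.real (E2 ∩ YB ∩ XZ) =
        μ.real (E2 ∩ XZ) * μ.real (E2 ∩ YB ∩ XZ) + μ.real (E2 ∩ YB ∩ XZ) * μ.real M := by ring
    have e2 : (μ.real (E2 ∩ YB ∩ XZ) + μ.real (D ∩ YB ∩ XBᶜ)) * μ.real (E2 ∩ XZ) =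
        μ.real (E2 ∩ XZ) * μ.real (E2 ∩ YB ∩ XZ) + μ.real (E2 ∩ XZ) * μ.real (D ∩ YB ∩ XBᶜ) := by ring
    linarith
  have hWnn : 0 ≤ μ.real (D ∩ (XB ∪ YB)) - μ.real (D ∩ ZB) := le_trans (h0 (D ∩ XB ∩ YBᶜ)) hW1
  have hT := @q7r5_arith (μ.real D) (μ.real M) (μ.real (D ∩ (openConn o x ∪ openConn o y)))
    (μ.real (E1 ∩ openConn o x)) (μ.real (E2 ∩ openConn o y)) (μ.real (D ∩ (XB ∪ YB)) - μ.real (D ∩ ZB))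
    (μ.real (D ∩ XB ∩ YBᶜ)) (μ.real (D ∩ YB ∩ XBᶜ)) (μ.real (E1 ∩ XB ∩ YZ)) (μ.real (E2 ∩ YB ∩ XZ))
    (μ.real (E1 ∩ YZ)) (μ.real (E2 ∩ XZ)) (μ.real (E2 ∩ XB)) (μ.real (E1 ∩ YB))
    (h0 D) (h0 _) (h0 _) (h0 _) (h0 _) hM hWnn hW1 hW2 hx2 hy1 F1' F2' hcond
  rw [sE1, sE2] at lev1
  have hfin : 0 ≤ ((μ.real (openConn o b ∩ (openConn o x ∪ openConn o y ∪ openConn o z)) -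
      μ.real (ZB ∩ (openConn o x ∪ openConn o y ∪ openConn o z))) * μ.real D) *
      (μ.real (E1 ∩ YZ) + μ.real M) * (μ.real (E2 ∩ XZ) + μ.real M) := by
    refine le_trans hT (le_trans (le_of_eq ?_) lev1)
    ring
  have hposE1 : 0 < μ.real (E1 ∩ YZ) + μ.real M := by linarith [h0 (E1 ∩ YZ)]
  have hposE2 : 0 < μ.real (E2 ∩ XZ) + μ.real M := by linarith [h0 (E2 ∩ XZ)]
  by_contra hlt
  have hlt' := not_le.mp hlt
  have hneg : ((μ.real (openConn o b ∩ (openConn o x ∪ openConn o y ∪ openConn o z)) -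
      μ.real (ZB ∩ (openConn o x ∪ openConn o y ∪ openConn o z))) * μ.real D) *
      (μ.real (E1 ∩ YZ) + μ.real M) * (μ.real (E2 ∩ XZ) + μ.real M) < 0 :=
    mul_neg_of_neg_of_pos (mul_neg_of_neg_of_pos (mul_neg_of_neg_of_pos (by linarith) hposD) hposE1) hposE2
  linarith

end

end Summit.CriticalPhenomena.PercolationContinuityZ3.Theorems
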